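import Literature.NumberTheory.GaloisCohomology.PoitouTateSha
import Literature.NumberTheory.GaloisRepresentations.TateH2VanishingArchimedean
import Literature.NumberTheory.GaloisRepresentations.ContinuousH2
import Literature.NumberTheory.GaloisRepresentations.ContinuousCorestriction
import Literature.NumberTheory.GaloisRepresentations.AbsGaloisGroupCompact
import Literature.NumberTheory.EllipticCurves.ZpExtension
import HarnessLib

/-!
# `Ker(H²(K, M) → H²(K_∞, M)) ⊆ Ш²(K, M)` once the finite local `H²` vanish, for a `ℤ_p`-extension `K_∞/K`

Topic `NumberTheory/GaloisCohomology`; namespace `Literature.NumberTheory.GaloisCohomology`.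
Theorems only (no definition, no named fact; D-0026).

Let `K` be a number field, `κ : Γ_K ↠ ℤ_p` a `ℤ_p`-extension (`ZpExtension K p`, kernel
`N = Gal(K̄/K_∞)`), and `M` a discrete `Γ_K`-module.  Two observations of the level-`K` bypass of
Greenberg's Λ-adic `H²` (LNM 1716 §4 Appendix; see the crux memo `PROP412-BYPASS.md` of K4
`SignedControlAtTwo`):

* `absGaloisRestrict_infinitePlace_mem_kerSubgroup` — **every archimedean decomposition group lies in
  `Gal(K̄/K_∞)`**: `Γ_{K_w}` is finite (`finite_absoluteGaloisGroup_completion_infinitePlace`, order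
  `≤ 2`) and `ℤ_p` is torsion-free, so `κ` is trivial on its image — every `ℤ_p`-extension is
  unramified (indeed split) at the infinite places (Washington, *Cyclotomic Fields*, §13.1);
* `localization_inl_eq_zero_of_resSubgroup_kerSubgroup_eq_zero` — hence a class of `H²(K, M)` that
  dies on `Gal(K̄/K_∞)` dies at every infinite place;
* `mem_shaTwo_of_resSubgroup_kerSubgroup_eq_zero` — **if moreover its localisations at all FINITE
  places vanish (e.g. because `H²(K_v, M) = 0` there), it lies in `Ш²(K, M)`** (`shaTwo`,
  `PoitouTateSha.lean`).

Combined with the Hochschild–Serre edge (`HochschildSerreEdgeCoinvariants.lean`: `res²` injective ⟹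
`H¹(K_∞, M) = (γ − 1) H¹(K_∞, M)`) this reduces the «(γ−1)-divisibility» of `H¹(K_∞, E[p^∞])` to the
vanishing of `Ш²(K, E[p^∞])` and of the local `H²(K_v, E[p^∞])`.  HONEST FRAMING: elementary
bookkeeping; nothing about any curve or summit is asserted.

## References
* L. Washington, *Introduction to Cyclotomic Fields* (1997), §13.1 (ℤ_p-extensions are unramified
  outside `p`; archimedean places split). [Washington1997]
* D. Harari, *Galois Cohomology and Class Field Theory* (2020), §17.3 Remark 17.12 (`Ш²`). [Harari2020]
* R. Greenberg, LNM 1716 (1999), §4 Appendix pp. 113–119. [GreenbergLNM1716]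
-/

noncomputable section

open CategoryTheory ContinuousCohomology Function NumberField
open _root_.TopRep _root_.Topology

universe u

namespace Literature.NumberTheory.GaloisCohomology

open Literature.NumberTheory.GaloisRepresentations Literature.NumberTheory.EllipticCurves Field

variable {K : Type u} [Field K] [NumberField K] {p : ℕ} [hp : Fact p.Prime] (κ : ZpExtension K p)

omit [NumberField K] in
/-- **Archimedean decomposition groups lie in `Gal(K̄/K_∞)`**: for an infinite place `w` of `K`,
the image of `Γ_{K_w} → Γ_K` is contained in `ker κ` (`Γ_{K_w}` is finite and `ℤ_p` has no
torsion). [cite: Washington1997, §13.1] -/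
theorem absGaloisRestrict_infinitePlace_mem_kerSubgroup (w : InfinitePlace K)
    (σ : absoluteGaloisGroup w.Completion) :
    absGaloisRestrict K w.Completion σ ∈ κ.kerSubgroup := by
  haveI := finite_absoluteGaloisGroup_completion_infinitePlace w
  rw [ZpExtension.mem_kerSubgroup]
  have hfin : IsOfFinOrder σ := isOfFinOrder_of_finite σ
  obtain ⟨n, hn, hσn⟩ := hfin.exists_pow_eq_one
  have h1 : (κ (absGaloisRestrict K w.Completion σ)) ^ n = 1 := by
    rw [← map_pow, ← map_pow, hσn, map_one, map_one]
  have h2 : n • (κ (absGaloisRestrict K w.Completion σ)).toAdd = 0 := by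
    rw [← toAdd_pow, h1, toAdd_one]
  have h3 : (κ (absGaloisRestrict K w.Completion σ)).toAdd = 0 :=
    (smul_eq_zero.mp h2).resolve_left hn.ne'
  rw [← ofAdd_toAdd (κ _), h3]
  rfl

variable {M : Type u} [AddCommGroup M] [TopologicalSpace M] [DiscreteTopology M]
  (ρ : DiscreteGaloisModule K M)

/-- **A class of `H²(K, M)` dying on `Gal(K̄/K_∞)` dies at every infinite place** (its localisation
at `w` is the restriction along `Γ_{K_w} → Gal(K̄/K_∞) → Γ_K`): on cocycles, if
`c|_{N × N} = ∂b` then `c|_{Γ_{K_w} × Γ_{K_w}} = ∂(b ∘ res)`. [cite: Washington1997, §13.1]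
[cite: SerreGaloisCohomology1997, I §2.4] -/
theorem localization_inl_eq_zero_of_resSubgroup_kerSubgroup_eq_zero (w : InfinitePlace K)
    (x : galoisCohomology ρ 2) (hx : resSubgroup ρ.toTopRep κ.kerSubgroup 2 x = 0) :
    galoisCohomology.localization ρ (Sum.inl w) 2 x = 0 := by
  haveI := absoluteGaloisGroup_compactSpace K
  haveI : T2Space (absoluteGaloisGroup K) := krullTopology_t2
  haveI : CompactSpace κ.kerSubgroup :=
    isCompact_iff_compactSpace.mp κ.isClosed_kerSubgroup.isCompact
  obtain ⟨c, rfl⟩ := twoCocycleClass_surjective ρ.toTopRep x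
  -- `res_N [c] = [c|_N] = 0`: a continuous `1`-cochain `b` on `N` with `c|_N = ∂b`
  rw [resSubgroup, map_twoCocycleClass, twoCocycleClass_eq_zero_iff] at hx
  obtain ⟨b, hb⟩ := hx
  -- the localisation at `w` is the pull-back along `f : Γ_{K_w} → Γ_K`, which factors through `N`
  let L : Type u := w.Completion
  haveI := absoluteGaloisGroup_compactSpace L
  haveI : T2Space (absoluteGaloisGroup L) := krullTopology_t2
  let f : absoluteGaloisGroup L →ₜ* absoluteGaloisGroup K := absGaloisRestrict K L
  have hfN : ∀ σ : absoluteGaloisGroup L, f σ ∈ κ.kerSubgroup :=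
    absGaloisRestrict_infinitePlace_mem_kerSubgroup κ w
  let f' : C(absoluteGaloisGroup L, κ.kerSubgroup) :=
    ⟨fun σ => ⟨f σ, hfN σ⟩, (map_continuous f).subtype_mk _⟩
  change (ContinuousCohomology.map f (X := ρ.toTopRep)
    (Y := DiscreteGaloisModule.toTopRep (ContinuousRep.restrict ρ f))
    (TopRep.ofHom ⟨ContinuousLinearMap.id ℤ M, fun _ => rfl⟩) 2).hom (twoCocycleClass ρ.toTopRep c) = 0
  rw [map_twoCocycleClass, twoCocycleClass_eq_zero_iff]
  refine ⟨b.comp f', fun σ τ => ?_⟩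
  have h := hb (f' σ) (f' τ)
  rw [contTwoCocycles.pullback_apply] at h ⊢
  have e : f' (σ * τ) = f' σ * f' τ := Subtype.ext (map_mul f σ τ)
  simp only [ContinuousMap.comp_apply]
  rw [e]
  exact h

/-- **`Ker(res : H²(K, M) → H²(Gal(K̄/K_∞), M)) ⊆ Ш²(K, M)` as soon as the localisations at the
finite places vanish** (for instance because `H²(K_v, M) = 0` at every finite `v`, as for
`M = E[p^∞]`): the infinite places are handled by
`localization_inl_eq_zero_of_resSubgroup_kerSubgroup_eq_zero`. [cite: Harari2020, §17.3 Remark 17.12]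
[cite: Washington1997, §13.1] -/
theorem mem_shaTwo_of_resSubgroup_kerSubgroup_eq_zero (x : galoisCohomology ρ 2)
    (hx : resSubgroup ρ.toTopRep κ.kerSubgroup 2 x = 0)
    (hfin : ∀ v : IsDedekindDomain.HeightOneSpectrum (𝓞 K),
      galoisCohomology.localization ρ (Sum.inr v) 2 x = 0) :
    x ∈ ρ.shaTwo := by
  rw [DiscreteGaloisModule.mem_shaTwo_iff]
  rintro (w | v)
  · exact localization_inl_eq_zero_of_resSubgroup_kerSubgroup_eq_zero κ ρ w x hx
  · exact hfin v

/-- The same with the hypothesis «`H²(K_v, M) = 0` at every finite place» spelled as a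
`Subsingleton`. [cite: Harari2020, §17.3 Remark 17.12] -/
theorem mem_shaTwo_of_resSubgroup_kerSubgroup_eq_zero_of_subsingleton (x : galoisCohomology ρ 2)
    (hx : resSubgroup ρ.toTopRep κ.kerSubgroup 2 x = 0)
    (hfin : ∀ v : IsDedekindDomain.HeightOneSpectrum (𝓞 K),
      Subsingleton (galoisCohomology (ρ.toLocal (Sum.inr v)) 2)) :
    x ∈ ρ.shaTwo :=
  mem_shaTwo_of_resSubgroup_kerSubgroup_eq_zero κ ρ x hx fun v =>
    haveI := hfin v; Subsingleton.elim _ _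

/-- **`Ш²(K, M) = 0` and `H²(K_v, M) = 0` at the finite places force
`res : H²(K, M) → H²(Gal(K̄/K_∞), M)` to be injective** — the hypothesis `hinj` of
`exists_conjMap_sub_eq_of_resSubgroup_two_injective` (`HochschildSerreEdgeCoinvariants.lean`).
[cite: Harari2020, §17.3 Remark 17.12] [cite: GreenbergLNM1716, §4 Appendix pp. 113–119] -/
theorem resSubgroup_kerSubgroup_two_eq_zero_imp_eq_zero (hsha : ρ.shaTwo = ⊥)
    (hfin : ∀ v : IsDedekindDomain.HeightOneSpectrum (𝓞 K),
      Subsingleton (galoisCohomology (ρ.toLocal (Sum.inr v)) 2))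
    (x : galoisCohomology ρ 2) (hx : resSubgroup ρ.toTopRep κ.kerSubgroup 2 x = 0) : x = 0 := by
  have h := mem_shaTwo_of_resSubgroup_kerSubgroup_eq_zero_of_subsingleton κ ρ x hx hfin
  rw [hsha] at h
  exact (AddSubgroup.mem_bot).1 h

end Literature.NumberTheory.GaloisCohomology

end
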